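import Summits.Parity.GeneralizedHardyLittlewood.Theorems.BeyondDiagonalBeatsQuarter.OffDiagDivisorSwitch
import Summits.Parity.GeneralizedHardyLittlewood.Theorems.BeyondDiagonalBeatsQuarter.OffDiagLevelAP
import Mathlib.RingTheory.Coprime.Lemmas
import HarnessLib

/-!
# Route `PrimeLevelFamEdge`, crux K_B (stmt-Parity-20343), line `diagonal_kernel_split` rev 4, plan Ω,
# KEYS-NEXT S3, part 2 (OMEGA-BLUEPRINT L6′, «STRATA») — **the inner LEVEL sum of the block switch is a
# `levelAPSum`: to modulus `|h₁|`, class `q ≡ −ab·(cs)⁻¹`, in the generic stratum `(cs, h₁) = 1`; to the reduced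
# modulus `|h₁|/g`, `g = gcd(cs, h₁)`, when `g ∣ ab`; and EMPTY otherwise or when `(h₁, c) > 1`**

After the block switch (`OffDiagBlockSwitch.sum_levels_sum_tsum_switch_eq`): for fixed switched dual variables `(h₁, s)`
the prime levels `q` of the block enter through `Σ_{q∈G} 𝟙[h₁ unit mod qc]·𝟙[h₁ ∣ ab + (qc)s]·x q` (`c = r+1` the
Petersson index, `ab = (l/d₁)(m/d₂)`, `x q` the switched box transform at level `q`). This file is the finite algebra
turning that into the objects of `OffDiagLevelAP` (GATE G2 §(a) a8 = a8P + a8R + a8S; BLUEPRINT §3b «STRATA left for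
L6′: (cs,h₁) = g_s > 1 (class mod |h₁|/g_s, solvable iff g_s ∣ ab)»):

* `isUnit_intCast_zmod_mul_iff`, `sum_levels_switch_eq_sum_filter` — for `(h₁, c) = 1` the unit condition is the
  filter `gcd(h₁, q) = 1` on the levels (for prime levels: `q ∤ h₁`, `filter_gcd_eq_one_eq_filter_not_dvd`);
  `sum_levels_switch_eq_zero_of_not_isCoprime` — for `(h₁, c) > 1` no level qualifies;
* `sum_ite_dvd_eq_levelAPSum`, **`sum_levels_switch_eq_levelAPSum`**, `sum_levels_switch_eq_principal_add_deviation` —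
  generic stratum `(cs, h₁) = 1`: the divisor condition is the class `q ≡ −ab(cs)⁻¹ (mod |h₁|)`
  (`OffDiagDivisorSwitch.dvd_iff_natCast_level_eq`), so the level sum IS
  `levelAPSum (G.filter (gcd(h₁,·)=1)) x |h₁| (−ab(cs)⁻¹) = levelPrincipal + levelDeviation`;
* `dvd_add_mul_iff_of_gcd`, `isCoprime_div_gcd`, **`sum_levels_switch_eq_levelAPSum_reduced`**,
  `sum_levels_switch_eq_zero_of_not_dvd` — the other `s`-strata: with `g = gcd(cs, h₁)` the condition is solvable only
  if `g ∣ ab`, and then it is the class `q ≡ −(ab/g)(cs/g)⁻¹ (mod |h₁|/g)`.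

Decidability of `h₁ unit mod qc` is a HYPOTHESIS of every statement displaying that indicator (under a sum over the
levels only the classical instance exists; per level `NeZero` gives the finite one) — so the lemmas rewrite in both
settings. Pure `ℤ`/`ZMod` algebra; theorems only; standard axioms. Helper toward `stub_offDiagBelowSlack_io`; closes
nothing (bounding `levelDeviation` is L7/L8, the principal part is L6).
«The programme SEARCHES and TYPES; no claim about Landau–Siegel zeros, Theorems 1–2 of arXiv:2211.02515 or
a repaired Margin232 until a kernel theorem says so.»
-/

namespace Summit.Parity.GeneralizedHardyLittlewood.Theorems.BeyondDiagonalBeatsQuarter.OffDiag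

open Finset

/-! ### §1. Unit condition as a filter; the generic stratum -/

/-- `h₁` is a unit mod `q·c` iff `h₁` is coprime to `q` and to `c`. [folklore] -/
theorem isUnit_intCast_zmod_mul_iff (h₁ : ℤ) (q c : ℕ) :
    IsUnit ((h₁ : ℤ) : ZMod (q * c)) ↔ IsCoprime h₁ (q : ℤ) ∧ IsCoprime h₁ (c : ℤ) := by
  rw [ZMod.coe_int_isUnit_iff_isCoprime, Nat.cast_mul, IsCoprime.mul_left_iff]
  exact ⟨fun h ↦ ⟨h.1.symm, h.2.symm⟩, fun h ↦ ⟨h.1.symm, h.2.symm⟩⟩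

/-- `(h₁, q) = 1` as the decidable test `gcd = 1`. [folklore] -/
theorem isCoprime_natCast_iff_gcd_eq_one (h₁ : ℤ) (q : ℕ) : IsCoprime h₁ (q : ℤ) ↔ Int.gcd h₁ q = 1 :=
  Int.isCoprime_iff_gcd_eq_one

/-- In the generic stratum the `c`-part of the unit condition is automatic: `(cs, h₁) = 1 ⇒ (h₁, c) = 1`. [folklore] -/
theorem isCoprime_of_isCoprime_mul_left {c s h₁ : ℤ} (h : IsCoprime (c * s) h₁) : IsCoprime h₁ c :=
  h.of_mul_left_left.symm

/-- **Unit condition as a filter on the levels.** If `(h₁, c) = 1` then for every family `x q`: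
`Σ_{q∈G} 𝟙[h₁ unit mod qc]·x q = Σ_{q ∈ G, gcd(h₁,q)=1} x q`. [folklore] -/
theorem sum_levels_switch_eq_sum_filter (G : Finset ℕ) {c : ℕ} {h₁ : ℤ}
    [∀ q : ℕ, Decidable (IsUnit ((h₁ : ℤ) : ZMod (q * c)))] (hc : IsCoprime h₁ (c : ℤ)) (x : ℕ → ℂ) :
    ∑ q ∈ G, (if IsUnit ((h₁ : ℤ) : ZMod (q * c)) then x q else 0) =
      ∑ q ∈ G.filter (fun q : ℕ ↦ Int.gcd h₁ q = 1), x q := by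
  rw [Finset.sum_filter]
  refine Finset.sum_congr rfl fun q _ ↦ ?_
  have hiff : IsUnit ((h₁ : ℤ) : ZMod (q * c)) ↔ Int.gcd h₁ q = 1 := by
    rw [isUnit_intCast_zmod_mul_iff, ← isCoprime_natCast_iff_gcd_eq_one]
    exact ⟨fun h ↦ h.1, fun h ↦ ⟨h, hc⟩⟩
  by_cases hu : Int.gcd h₁ q = 1
  · rw [if_pos (hiff.mpr hu), if_pos hu]
  · rw [if_neg (fun h ↦ hu (hiff.mp h)), if_neg hu]

/-- **The divisor condition is a class: the inner level sum is a `levelAPSum`.** For integers `n` (the dual modulus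
`h₁`), `m` (`= cs`) with `(m, n) = 1`, `A` (`= ab`), a finite set of levels `Q` and weights `x`:
`Σ_{q∈Q} 𝟙[n ∣ A + q·m]·x q = levelAPSum Q x |n| (−A·m⁻¹)` (`dvd_iff_natCast_level_eq`). [folklore] -/
theorem sum_ite_dvd_eq_levelAPSum (Q : Finset ℕ) (x : ℕ → ℂ) {n m A : ℤ} (hmn : IsCoprime m n) :
    ∑ q ∈ Q, (if n ∣ A + (q : ℤ) * m then x q else 0) =
      levelAPSum Q x n.natAbs (-((A : ℤ) : ZMod n.natAbs) * (((m : ℤ) : ZMod n.natAbs))⁻¹) := by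
  classical
  rw [levelAPSum, Finset.sum_filter]
  refine Finset.sum_congr rfl fun q _ ↦ ?_
  have hiff := dvd_iff_natCast_level_eq (A := A) hmn q
  rw [Int.cast_natCast] at hiff
  by_cases hd : n ∣ A + (q : ℤ) * m
  · rw [if_pos hd, if_pos (hiff.mp hd)]
  · rw [if_neg hd, if_neg (fun h ↦ hd (hiff.mpr h))]

/-- **The inner level sum of the block switch, generic stratum.** For a finite set of levels `G`, a Petersson index
`c`, integers `a, b` and a switched pair `(h₁, s)` in the generic stratum `(cs, h₁) = 1`, and any weights `x q`
(`= Φ̂_q(h₁/(qc), s/h₁ + ab/(h₁qc))·…` at fixed `(h₁, s)`):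
`Σ_{q∈G} 𝟙[h₁ unit mod qc]·𝟙[h₁ ∣ ab + (qc)s]·x q = levelAPSum (G.filter (gcd(h₁,·)=1)) x |h₁| (−ab·(cs)⁻¹)`
— the levels run over ONE arithmetic progression to modulus `|h₁|` (the home of a8P/a8R/a8S).
[cite: KowalskiMichelVanderKam2000, Lemma 3.3 p. 9 — derivation] -/
theorem sum_levels_switch_eq_levelAPSum (G : Finset ℕ) (c : ℕ) (a b : ℤ) {h₁ s : ℤ}
    [∀ q : ℕ, Decidable (IsUnit ((h₁ : ℤ) : ZMod (q * c)))] (hcop : IsCoprime ((c : ℤ) * s) h₁) (x : ℕ → ℂ) :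
    ∑ q ∈ G, (if IsUnit ((h₁ : ℤ) : ZMod (q * c)) then
        (if h₁ ∣ a * b + ((q * c : ℕ) : ℤ) * s then x q else 0) else 0) =
      levelAPSum (G.filter (fun q : ℕ ↦ Int.gcd h₁ q = 1)) x h₁.natAbs
        (-((a * b : ℤ) : ZMod h₁.natAbs) * ((((c : ℤ) * s : ℤ) : ZMod h₁.natAbs))⁻¹) := by
  rw [sum_levels_switch_eq_sum_filter G (isCoprime_of_isCoprime_mul_left hcop)]
  have hre : ∀ q : ℕ, a * b + ((q * c : ℕ) : ℤ) * s = a * b + (q : ℤ) * ((c : ℤ) * s) := by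
    intro q; push_cast; ring
  simp_rw [hre]
  exact sum_ite_dvd_eq_levelAPSum _ x hcop

/-- **… hence principal part plus deviation** (`OffDiagLevelAP.levelAPSum_eq_principal_add_deviation`): in the generic
stratum the inner level sum of the block switch is
`levelPrincipal Q x |h₁| + levelDeviation Q x |h₁| (−ab(cs)⁻¹)`, `Q = G.filter (gcd(h₁,·)=1)` — a8P + (a8R/a8S).
[cite: KowalskiMichelVanderKam2000, Lemma 3.3 p. 9 — derivation] -/
theorem sum_levels_switch_eq_principal_add_deviation (G : Finset ℕ) (c : ℕ) (a b : ℤ) {h₁ s : ℤ}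
    [∀ q : ℕ, Decidable (IsUnit ((h₁ : ℤ) : ZMod (q * c)))] (hcop : IsCoprime ((c : ℤ) * s) h₁) (x : ℕ → ℂ) :
    ∑ q ∈ G, (if IsUnit ((h₁ : ℤ) : ZMod (q * c)) then
        (if h₁ ∣ a * b + ((q * c : ℕ) : ℤ) * s then x q else 0) else 0) =
      levelPrincipal (G.filter (fun q : ℕ ↦ Int.gcd h₁ q = 1)) x h₁.natAbs +
        levelDeviation (G.filter (fun q : ℕ ↦ Int.gcd h₁ q = 1)) x h₁.natAbs
          (-((a * b : ℤ) : ZMod h₁.natAbs) * ((((c : ℤ) * s : ℤ) : ZMod h₁.natAbs))⁻¹) := by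
  rw [sum_levels_switch_eq_levelAPSum G c a b hcop x, levelAPSum_eq_principal_add_deviation]

/-- **For prime levels the coprimality filter is `q ∤ h₁`.** [folklore] -/
theorem filter_gcd_eq_one_eq_filter_not_dvd (G : Finset ℕ) (hG : ∀ q ∈ G, q.Prime) (h₁ : ℤ) :
    G.filter (fun q : ℕ ↦ Int.gcd h₁ q = 1) = G.filter (fun q : ℕ ↦ ¬ (q : ℤ) ∣ h₁) := by
  refine Finset.filter_congr fun q hq ↦ ?_
  rw [Int.gcd_comm, Int.gcd_eq_natAbs, Int.natAbs_natCast, ← Nat.coprime_iff_gcd_eq_one,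
    Nat.Prime.coprime_iff_not_dvd (hG q hq), Int.natCast_dvd]

/-! ### §2. The other `s`-strata: reduced modulus, or nothing -/

/-- **Divisibility with a common factor.** For integers `n ≠ 0`, `m`, `A` and `g = gcd(m, n)`:
`n ∣ A + q·m ⟺ g ∣ A ∧ n/g ∣ A/g + q·(m/g)`. [folklore] -/
theorem dvd_add_mul_iff_of_gcd {n m A : ℤ} (hn : n ≠ 0) {g : ℕ} (hg : Int.gcd m n = g) (q : ℤ) :
    n ∣ A + q * m ↔ (g : ℤ) ∣ A ∧ n / g ∣ A / g + q * (m / g) := by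
  have hgm : (g : ℤ) ∣ m := hg ▸ Int.gcd_dvd_left m n
  have hgn : (g : ℤ) ∣ n := hg ▸ Int.gcd_dvd_right m n
  have hg0 : (g : ℤ) ≠ 0 := by
    rw [← hg]
    exact_mod_cast (Int.gcd_pos_of_ne_zero_right m hn).ne'
  obtain ⟨m', rfl⟩ := hgm
  obtain ⟨n', rfl⟩ := hgn
  rw [Int.mul_ediv_cancel_left _ hg0, Int.mul_ediv_cancel_left _ hg0]
  constructor
  · intro h
    have hgA : (g : ℤ) ∣ A := by
      have h1 : (g : ℤ) ∣ A + q * ((g : ℤ) * m') := dvd_trans (dvd_mul_right _ _) h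
      have h2 : (g : ℤ) ∣ q * ((g : ℤ) * m') := dvd_mul_of_dvd_right (dvd_mul_right _ _) _
      exact (dvd_add_left h2).mp h1
    obtain ⟨A', rfl⟩ := hgA
    refine ⟨dvd_mul_right _ _, ?_⟩
    rw [Int.mul_ediv_cancel_left _ hg0]
    have : (g : ℤ) * n' ∣ (g : ℤ) * (A' + q * m') := by
      rw [show (g : ℤ) * (A' + q * m') = (g : ℤ) * A' + q * ((g : ℤ) * m') by ring]; exact h
    exact (mul_dvd_mul_iff_left hg0).mp this
  · rintro ⟨hgA, h⟩
    obtain ⟨A', rfl⟩ := hgA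
    rw [Int.mul_ediv_cancel_left _ hg0] at h
    rw [show (g : ℤ) * A' + q * ((g : ℤ) * m') = (g : ℤ) * (A' + q * m') by ring]
    exact mul_dvd_mul_left _ h

/-- The reduced pair is coprime: `(m/g, n/g) = 1` for `g = gcd(m, n)`, `n ≠ 0`. [folklore] -/
theorem isCoprime_div_gcd {n m : ℤ} (hn : n ≠ 0) {g : ℕ} (hg : Int.gcd m n = g) :
    IsCoprime (m / g) (n / g) := by
  rw [Int.isCoprime_iff_gcd_eq_one, ← hg]
  exact Int.gcd_div_gcd_div_gcd (Int.gcd_pos_of_ne_zero_right m hn)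

/-- **The inner level sum of the block switch, reduced-modulus stratum.** For `(h₁, c) = 1`, `h₁ ≠ 0`, and
`g = gcd(cs, h₁)` DIVIDING `ab`: the divisor condition `h₁ ∣ ab + q·cs` is the class
`q ≡ −(ab/g)·(cs/g)⁻¹ (mod |h₁|/g)`, so
`Σ_{q∈G} 𝟙[h₁ unit mod qc]·𝟙[h₁ ∣ ab + (qc)s]·x q = levelAPSum (G.filter (gcd(h₁,·)=1)) x (|h₁|/g) (−(ab/g)(cs/g)⁻¹)`
(the generic stratum is `g = 1`; `s = 0` gives `g = |h₁|`, modulus `1`). [folklore] -/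
theorem sum_levels_switch_eq_levelAPSum_reduced (G : Finset ℕ) (c : ℕ) (a b : ℤ) {h₁ : ℤ}
    [∀ q : ℕ, Decidable (IsUnit ((h₁ : ℤ) : ZMod (q * c)))] (hh₁ : h₁ ≠ 0) (s : ℤ)
    (hc : IsCoprime h₁ (c : ℤ)) {g : ℕ} (hg : Int.gcd ((c : ℤ) * s) h₁ = g) (hgab : (g : ℤ) ∣ a * b)
    (x : ℕ → ℂ) :
    ∑ q ∈ G, (if IsUnit ((h₁ : ℤ) : ZMod (q * c)) then
        (if h₁ ∣ a * b + ((q * c : ℕ) : ℤ) * s then x q else 0) else 0) =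
      levelAPSum (G.filter (fun q : ℕ ↦ Int.gcd h₁ q = 1)) x (h₁ / g).natAbs
        (-((a * b / g : ℤ) : ZMod (h₁ / g).natAbs) *
          ((((c : ℤ) * s / g : ℤ) : ZMod (h₁ / g).natAbs))⁻¹) := by
  rw [sum_levels_switch_eq_sum_filter G hc]
  have hre : ∀ q : ℕ, (h₁ ∣ a * b + ((q * c : ℕ) : ℤ) * s) ↔
      h₁ / g ∣ a * b / g + (q : ℤ) * ((c : ℤ) * s / g) := by
    intro q
    rw [show a * b + ((q * c : ℕ) : ℤ) * s = a * b + (q : ℤ) * ((c : ℤ) * s) by push_cast; ring,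
      dvd_add_mul_iff_of_gcd hh₁ hg]
    exact ⟨fun h ↦ h.2, fun h ↦ ⟨hgab, h⟩⟩
  simp_rw [hre]
  exact sum_ite_dvd_eq_levelAPSum _ x (isCoprime_div_gcd hh₁ hg)

/-- **Unsolvable stratum**: if `g = gcd(cs, h₁)` does NOT divide `ab`, no level satisfies the divisor condition and the
inner level sum vanishes. [folklore] -/
theorem sum_levels_switch_eq_zero_of_not_dvd (G : Finset ℕ) (c : ℕ) (a b : ℤ) {h₁ : ℤ}
    [∀ q : ℕ, Decidable (IsUnit ((h₁ : ℤ) : ZMod (q * c)))] (hh₁ : h₁ ≠ 0) (s : ℤ)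
    {g : ℕ} (hg : Int.gcd ((c : ℤ) * s) h₁ = g) (hgab : ¬ (g : ℤ) ∣ a * b) (x : ℕ → ℂ) :
    ∑ q ∈ G, (if IsUnit ((h₁ : ℤ) : ZMod (q * c)) then
        (if h₁ ∣ a * b + ((q * c : ℕ) : ℤ) * s then x q else 0) else 0) = 0 := by
  refine Finset.sum_eq_zero fun q _ ↦ ?_
  have hnd : ¬ (h₁ ∣ a * b + ((q * c : ℕ) : ℤ) * s) := by
    rw [show a * b + ((q * c : ℕ) : ℤ) * s = a * b + (q : ℤ) * ((c : ℤ) * s) by push_cast; ring,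
      dvd_add_mul_iff_of_gcd hh₁ hg]
    exact fun h ↦ hgab h.1
  rw [if_neg hnd]
  exact ite_self 0

/-- **Dual moduli sharing a factor with the Petersson index contribute nothing**: if `(h₁, c) ≠ 1` then `h₁` is a
unit mod `qc` for NO level `q`, and the inner level sum vanishes (any summand `y q`). [folklore] -/
theorem sum_levels_switch_eq_zero_of_not_isCoprime (G : Finset ℕ) {c : ℕ} {h₁ : ℤ}
    [∀ q : ℕ, Decidable (IsUnit ((h₁ : ℤ) : ZMod (q * c)))] (hc : ¬ IsCoprime h₁ (c : ℤ)) (y : ℕ → ℂ) :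
    ∑ q ∈ G, (if IsUnit ((h₁ : ℤ) : ZMod (q * c)) then y q else 0) = 0 := by
  refine Finset.sum_eq_zero fun q _ ↦ ?_
  rw [if_neg]
  rw [isUnit_intCast_zmod_mul_iff]
  exact fun h ↦ hc h.2

end Summit.Parity.GeneralizedHardyLittlewood.Theorems.BeyondDiagonalBeatsQuarter.OffDiag
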